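import Literature.NumberTheory.EllipticCurves.Cha2005.ShaIndexBoundIrreducible
import Literature.NumberTheory.EllipticCurves.Tamagawa
import HarnessLib

/-!
# Miller 2011, Thm. 5.4 under the hypotheses of Thm. 4.4 (Kolyvagin): Jetchev's Tamagawa sharpening of the Heegner-index bound for SURJECTIVE `ρ̄_{E,p}`, no clause on `N`

HONEST FRAMING (cell `pub/bsd-jet`, T1 JET of the BSD rank-`≤ 1` LITERATURE→PARTITION programme,
verbatim): «no tranche here proves BSD; ARM L moves the LITERAL column of an r ≤ 1 census into the
kernel-proved-modulo-named-print column; ARM P changes what "named print" is worth.» This file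
vendors ONE published statement as a named fact (`def … : Prop`, nothing asserted; D-0014) plus
three PROVED numeric corollaries. It changes no label and books nothing; typed ≠ proved ≠ endorsed.

## Why this file exists (seat `bsd-jet-lit-ty`, 2026-08-26)

The sibling file `Miller2011/JetchevBoundIrreducible.lean` vendors Miller's Thm. 5.4 under the
hypotheses of his Thm. 5.2 (Cha: `p ∤ 2·Δ(K)`, `p² ∤ N`, `ρ̄_{E,p}` irreducible) — the case the
cell `b2b-bsdres` needed for NON-surjective images (class X9). But Thm. 5.4 is printed for THREE
hypothesis sets, the first of which is Thm. 4.4 (Kolyvagin–Gross–Zagier: `r_an(E) ≤ 1`, `p` odd,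
`ρ̄_{E,p}` surjective) and carries NO clause relating `p` to `N` or to `d_K`. The census lane's
register books every `JET@p∣N` cell on the base row `T-KOLY` (surjective image; the tree's
`HypothesisSweep/IndexSchema.lean` records the row `JET` as "Miller Thm 5.4 under the hypotheses of
`KOLY` or `CHA` … LITERAL with flag `JETpN` when `p ∣ N`"), and 97 646 of those cells have `p² ∣ N`
(additive reduction at `p`; census `pub/bsd-jet/census-jet/CENSUS-JET-ROWS.md` §3), where the Cha
case does not apply at all. This file is the by-name binder for that reading: the SURJECTIVE case,
exactly as printed.

## Sources and what was read (store `paper:arxiv-1010.2431`, chunk pages pNNNN = arXiv text)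

* R. L. Miller, *Proving the Birch and Swinnerton-Dyer conjecture for specific elliptic curves of
  analytic rank zero and one*, LMS J. Comput. Math. **14** (2011) 327–350 = arXiv:1010.2431
  (theorem numbers below are those of the arXiv text, as in every tree citation of this paper).
  - §4 setting [p0009 L3]: `E/ℚ` of conductor `N`; "`K = ℚ(√D)` satisfies the Heegner hypothesis
    for `E` if each prime `p ∣ N` splits in `K`"; "We fix a modular parametrization
    `ψ : X₀(N) → E` of minimal degree taking `∞` to `O` … the Heegner point is
    `y_K := Tr_{H/K}(φ(x_1)) ∈ E(K)` … Define `I_K := [E(K)_{/tors} : ℤ y_K]`, which we call the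
    Heegner index."
  - **Thm. 4.2** (Kolyvagin) [p0009 L22–29]: "If `y_K` is nontorsion, then `E(K)` has rank 1
    (hence `I_K < ∞`), `Ш(K, E)` is finite and `c₃ I_K Ш(K,E) = 0` and `#Ш(K,E) ∣ c₄ I_K²` … The
    primes dividing `c₄` are at most `2` and the odd primes `p` for which `ρ̄_{E,p}` is [not]
    surjective." **Cor. 4.3** [L31–35]: "`Ш(ℚ,E)` and `Ш(ℚ,E^D)` are finite and have orders
    whose odd parts divide `c₄ I_K²`" (by Lemma 2.2 `qit_sha`).
  - **Thm. 4.4** ("big-result") [p0009 L38–45]: "If `r_an(E) ≤ 1`, then `y_K` is nontorsion. In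
    particular, `r(E) = r_an(E)`, `Ш(ℚ, E)` is finite, and if `p` is an odd prime unramified in the
    CM field such that `ρ̄_{E,p}` is surjective, then `ord_p(#Ш(ℚ, E)) ≤ 2 · ord_p(I_K)`."
    (§3 [p0007 L3–5]: for `E` without CM "`R = ℤ`, `K = ℚ` and the groups `Aut_R(E[p])` and
    `Aut(E[p]) ≅ GL₂(𝔽_p)` are identical", so "unramified in the CM field" is void and
    "surjective" means onto `GL₂(𝔽_p)`; for CM curves Miller's "surjective" means onto
    `Aut_R(E[p]) ⊊ Aut(E[p])`, a case NOT vendored here — see Faithfulness.)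
  - **Thm. 5.4 (Jetchev)** [p0011 L42–50]: "Jetchev [jetchev_m_max] has improved the upper bound
    with the following: If the hypotheses of any of Theorems (big-result) [4.4], (cha) [5.2] or
    (stein-et-al) [5.3] apply to `p`, then
    `ord_p(#Ш(ℚ, E)) ≤ 2 · (ord_p(I_K) − max_{q∣N} ord_p(c_q))`. If `p` divides at most one
    Tamagawa number then this upper bound is equal to `ord_p(#Ш(ℚ,E)_an)`."
  - Miller's OWN USES of the Thm.-4.4 case of Thm. 5.4 AT PRIMES `p ∣ N` (load-bearing in the
    proofs of his main theorems for `N < 5000`): Thm. 7.5, rank 0 [p0014 L40–42]: "Suppose that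
    `E[p]` is surjective. In this case we need only consider primes dividing the conductor `N`. For
    such pairs `(E,p)`, we can compute the Heegner index or an upper bound for it, which gives an
    upper bound on `ord_p(Ш(ℚ,E))`. When the results of Kolyvagin and Jetchev were not strong
    enough …"; §8 [p0015 L3–5]: "We are now left to consider the 1964 pairs `(E,p)` for which `E`
    has additive reduction at `p`. … Now we may also assume that `E[p]` is surjective. In these
    cases, Heegner index computations sufficed to prove `BSD(E, p)`, using Theorem (big-result) and
    Theorem (jetchev)"; and before Prop. 7.6 [p0015 L11–19]: "for `(E,p) = (1155k, 7)`, we have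
    `c₃(E) = 7`, `c₅(E) = 7`, `ord_7(#Ш(ℚ,E)_an) = 0` and `ord_7(#Ш(ℚ,E)) ≤ 2`, by Theorem
    (jetchev)" (`7 ∥ 1155`, non-split multiplicative).
* D. Jetchev, *Global divisibility of Heegner points and Tamagawa numbers*, Compos. Math. **144**
  (2008) 811–826 = arXiv:math/0703431 [store `paper:arxiv-math_0703431` p0003 L32–36, L72–86]:
  Thm. 1.4 (`m_∞ ≥ m_max`) and Cor. 1.5 (`#Ш(E/K)[p^∞] ≤ p^{2m₀ − 2m_max}`) under "Hypothesis (\*):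
  `p ∤ N` and … `ρ_{E,p}` is surjective", optimal parametrisation. Tree:
  `Jetchev2008.cor15_padicValNat_card_primaryComponent_sha_le` (Cor. 1.5 AS PRINTED, over `K`) and
  `Jetchev2008.thm14_derivedPoint_divisible_of_le_padicValNat_tamagawa` (Thm. 1.4 AS PRINTED).
* G. Grigorov, A. Jorza, S. Patrikis, W. Stein, C. Tarniţă, Math. Comp. **78** (2009) 2397–2425,
  §3.1 Thm. 3.4 (Kolyvagin, surjective `ρ̄_{E,p}`, `p` odd; the paper's statement adds `p ∤ D_K`)
  and Rem. 3.13 ("Conjecture 3.12 implies that the index … will be divisible by the Tamagawa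
  numbers `c_p` … hence the bound in Theorems 3.4, 3.5 and 3.7 can be very weak")
  [store `paper:doi-10-1090-s0025-5718-09-02253-4` p0010 L3, p0011 L11] — NO Jetchev-type
  statement is printed there; Miller's Thm. 5.4 is the printed statement of record.
* presearch (D-0021; this seat and `b2b-bsdres` X9 GEN 7): `lit search --hybrid "Jetchev Tamagawa
  Heegner index bound conductor dividing p"`, `lit vsearch "Kolyvagin bound sharpened by Tamagawa
  numbers at a prime of bad reduction"`, galaxy `"Heegner index|Tamagawa number" --star all` → the
  only printed statements of the Tamagawa-sharpened bound are Jetchev 2008 (Hyp. (\*): `p ∤ N`) and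
  Miller 2011 Thm. 5.4 (no `N`-clause in the Thm.-4.4 case); later work (W. Zhang 2014, Jetchev–
  Skinner–Wan 2017 §7.4, Kim arXiv:2203.12161, Burungale–Castella–Grossi–Skinner arXiv:2312.09301)
  uses Jetchev's theorem at GOOD `p` only. Hence the flag below.

## FLAG `JET@p∣N` on this binder (for the referee; recorded, not hidden)

The statement vendored here is a numbered theorem of a refereed paper (LMS JCM 14, Thm. 5.4 with
the hypotheses of Thm. 4.4), applied BY ITS AUTHOR at primes `p ∣ N` — additive (§8, 1 964 pairs)
and multiplicative (Thm. 7.5; 1155k at `p = 7`) — in the proofs of the paper's main theorems, and is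
therefore a PUBLISHED statement in the census's sense (R9.1: a refereed statement is cited with its
printed hypotheses; inputs of its proof are the author's). Its printed justification is the citation
of Jetchev 2008, whose Thm. 1.4 / Cor. 1.5 are printed under Hypothesis (\*) — `p ∤ N` AND `ρ̄`
surjective. In the case vendored HERE the image hypothesis is (\*)'s own; the ONLY gap between
Miller's sentence and Jetchev's print is the clause `p ∤ N` when the fact is instantiated at a prime
`p ∣ N`. That is exactly the register's flag `JET@p∣N` (lane `T-KOLY` + `JET`), which every pair
closed through this fact at `p ∣ N` carries until the referee rules otherwise; at `p ∤ N` the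
sentence is Jetchev's Cor. 1.5 followed by Miller's Cor. 4.3 (odd parts of `#Ш(ℚ,E)` divide
`#Ш(K,E)`), verbatim. The T1 reading road (`pub/bsd-jet/JET-PLAN.md` §1 R; lead memo
`sheets/LEAD-MEMO-JET-localconditions-v1.md`) records WHERE `p ∤ N` enters Jetchev's printed proof:
only Rem. 1.2 (Manin constant; outside Thm. 1.4) and Lemma 4.3 (`v ∤ p ⇒ E⁰(K_v^ur)` is
`p`-divisible) at the stringent places `v ∣ q`, `q` the prime with `ord_p c_q = m_max` — so for a
carrier `q ≠ p` the printed proof is read as running verbatim, and for `q = p` (split `I_n` at `p`,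
`p ∣ n`) Lemma 4.3 is unavailable (a typed gap). Those are READINGS for the referee's desk, not
content of this file: nothing here asserts the fact, and no consumer may drop the flag on its own.

## Faithfulness notes

* Printed: `ord_p #Ш(ℚ,E) ≤ 2(ord_p I_K − max_{q∣N} ord_p c_q)`. Vendored, as in the sibling Cha
  file and in `Jetchev2008.cor15_…`, in the MONOTONE form: for EVERY prime `q ∣ N`,
  `ord_p #Ш(E/ℚ) + 2·ord_p c_q ≤ 2·ord_p [E(K) : ℤ P]` — verbatim for the `q` attaining the
  maximum, weaker for the others —, and with the FULL index `[E(K) : ℤ P]`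
  (`AddSubgroup.index (zmultiples P)`), which is `#E(K)_tors · I_K` for the minimal-degree
  parametrisation (`P` of infinite order meets the torsion trivially) and `|n| · #E(K)_tors · I_K`
  for the Heegner point of any other parametrisation datum admitted by `IsHeegnerPoint N W K P`
  (every `X₀(N) → E`, `∞ ↦ O`, factors through the optimal quotient and `Hom(E_opt, E) ≅ ℤ` for
  non-CM `E`, so it is an integer multiple of the minimal one) — so the vendored inequality is
  IMPLIED by the printed one (weaker, never stronger).
* Hypotheses = those of Thm. 4.4 word for word for a curve WITHOUT complex multiplication:
  `p ≠ 2`, `ρ̄_{E,p} : Γ_ℚ → Aut(E[p])` surjective (`Surj W p` =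
  `WeierstrassCurve.HasSurjectiveModNGaloisRep`, the currency of
  `Kolyvagin1990_padicValNat_card_sha_le` and of `Jetchev2008.cor15_…`), `W.analyticRank ≤ 1`,
  `K` imaginary quadratic with the Heegner hypothesis for the level `N`, `P = y_K` a Heegner point
  (`IsHeegnerPoint N W K P`) of infinite order (`¬ IsOfFinAddOrder P`; Thm. 4.4 DERIVES
  non-torsion for a suitably chosen `K` — recording it as a binder is weaker than print and is what
  Thm. 4.2 / Cor. 4.3 consume), plus `q` prime with `q ∣ N` and
  `c_q = (W.baseChange ℚ_[q]).localTamagawaNumber ℤ_[q]` (file `Tamagawa`, the `ℤ_q`-minimal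
  model) as in the Jetchev and Cha files; `#Ш(ℚ,E)` = `W.shaOrder`. NO `¬ W.HasCM` binder: for an
  odd prime `p`, surjectivity onto `Aut(E[p]) ≅ GL₂(𝔽_p)` already excludes CM (the image of a CM
  curve normalises a Cartan subgroup), exactly as recorded in `KolyvaginShaIndexBound.lean`; the CM
  clause of Thm. 4.4 ("unramified in the CM field", surjective onto `Aut_R(E[p])`) is a different
  statement and is not vendored.
  -- TODO(general form): the CM case of Thm. 4.4 / 5.4 once the tree has the `R`-linear image predicate.
* NO clause relating `p` to `N` and NO clause relating `p` to `d_K`: none is printed in Thm. 4.4 /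
  5.4 (Thm. 5.2's `p ∤ 2·Δ(K)`, `p² ∤ N` belong to the Cha case only). GJPST 2009 Thm. 3.4 prints
  Kolyvagin's bound with `p ∤ D_K`; that restriction enters the expository chain only through
  [Gross 1991, Prop. 9.1] and is dispensable for odd surjective `p` — see the scope note in
  `Jetchev2008/HeegnerIndexTamagawaBound.lean` (Matar–Nekovář 2019 §0.4, Prop. 6.4–6.5). Consumers
  holding `p ∤ d_K` anyway lose nothing.
* JUNK VALUES: under the binders `Ш(E/ℚ)` is finite (Gross–Zagier–Kolyvagin, `r_an ≤ 1`) and the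
  index is a positive integer (Kolyvagin: `rank E(K) = 1` when `y_K` has infinite order), so neither
  `Nat.card = 0` junk case occurs within the hypotheses; `c_q ≠ 0`
  (`localTamagawaNumber_padic_ne_zero`). Same discussion as the sibling files.
* `[W.IsGloballyMinimal]` is carried for uniformity with the Cha sibling and its Summits consumers
  (`BSDp W p` is stated on the minimal model); it only weakens the fact.
* Size XL (Kolyvagin's Euler system + Jetchev §§4–6 + the `p ∣ N` reading); no `_holds`.

## Contents

* `thm54_surj_padicValNat_shaOrder_add_tamagawa_le` — the named fact (Thm. 5.4, case Thm. 4.4).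
* `padicValNat_shaOrder_eq_zero_of_index_le_tamagawa_of_surj` — the certificate case
  `ord_p [E(K) : ℤ y_K] ≤ ord_p c_q` for one `q ∣ N` ⇒ `ord_p #Ш(E/ℚ) = 0` (PROVED from the fact).
* `padicValNat_shaOrder_le_of_index_sub_tamagawa_of_surj` — the numeric form
  `ord_p #Ш(E/ℚ) ≤ 2(v − w)` from `ord_p [E(K):ℤP] ≤ v`, `w ≤ ord_p c_q` (PROVED).
* `padicValNat_shaOrder_le_two_mul_index_of_surj` — Thm. 4.4's own bound
  `ord_p #Ш(E/ℚ) ≤ 2·ord_p [E(K):ℤP]` recovered from the fact at any `q ∣ N` (PROVED).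
-/

noncomputable section

open scoped Classical

open WeierstrassCurve Literature.NumberTheory.EllipticCurves
  Literature.NumberTheory.EllipticCurves.Rank1Residual

namespace Literature.NumberTheory.EllipticCurves.Miller2011

/-- **Miller 2011, Thm. 5.4 (Jetchev's bound) under the hypotheses of Thm. 4.4 (Kolyvagin,
surjective `ρ̄_{E,p}`)** — R. L. Miller, LMS J. Comput. Math. 14 (2011), arXiv:1010.2431 p. 11:
"If the hypotheses of any of Theorems 4.4, 5.2 or 5.3 apply to `p`, then
`ord_p(#Ш(ℚ, E)) ≤ 2·(ord_p(I_K) − max_{q∣N} ord_p(c_q))`", here with Thm. 4.4's hypotheses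
(p. 9: "`r_an(E) ≤ 1` … `p` is an odd prime unramified in the CM field such that `ρ̄_{E,p}` is
surjective"; setting of §4: `K` quadratic imaginary with every prime of `N` split, `y_K` the Heegner
point of the minimal-degree parametrisation, `I_K = [E(K)_{/tors} : ℤ y_K]`, `c_q` the Tamagawa
numbers of `E/ℚ`). NO clause relating `p` to `N` or to `d_K` is printed in this case, and Miller
applies it at primes `p ∣ N` (additive: §8 p. 15, the 1 964 pairs; multiplicative: Thm. 7.5 p. 14 and
1155k at `p = 7`, p. 15). Vendored for `E/ℚ` (minimal model `W`) with `ρ̄_{E,p}` surjective onto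
`Aut(E[p])` (`Surj W p`; for odd `p` this excludes CM, whose Thm.-4.4 clause is not vendored), in the
monotone form: for every prime `q ∣ N`,
`ord_p #Ш(E/ℚ) + 2·ord_p c_q ≤ 2·ord_p [E(K) : ℤ P]` (full index; weaker than print, see the module
docstring). FLAG `JET@p∣N` when instantiated at `p ∣ N`: the printed proof is the citation
"Jetchev [Compos. Math. 144 (2008)]", whose Thm. 1.4 / Cor. 1.5 carry Hypothesis (\*) (`p ∤ N`,
`ρ̄` surjective) — the image hypothesis agrees, the `p ∤ N` clause is the gap; at `p ∤ N` the
sentence is Jetchev Cor. 1.5 + Miller Cor. 4.3 verbatim. Size XL; no `_holds`.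
[cite: Miller2011LMS, Thm. 5.4 (arXiv:1010.2431 p. 11 L42–L50); Thm. 4.4 (p. 9 L38–45); Thm. 4.2 / Cor. 4.3 (p. 9); §8 (p. 15 L3–5, L11–19); Thm. 7.5 (p. 14 L40–42)]
[cite: Jetchev2008, Hypothesis (*), Thm. 1.4, Cor. 1.5 (p. 3)]
[cite: GrigorovJorzaPatrikisSteinTarnita2009, §3.1 Thm. 3.4 and Rem. 3.13] -/
def thm54_surj_padicValNat_shaOrder_add_tamagawa_le : Prop :=
  ∀ (W : WeierstrassCurve ℚ) [W.IsElliptic] [W.IsGloballyMinimal] (N : ℕ) [NeZero N]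
    (K : Type) [Field K] [NumberField K] (_hK : IsImaginaryQuadratic K)
    (_hH : SatisfiesHeegnerHypothesis N K) (P : (W.baseChange K).toAffine.Point)
    (_hP : IsHeegnerPoint N W K P) (_hnt : ¬ IsOfFinAddOrder P) (p : ℕ) [Fact p.Prime]
    (q : ℕ) [Fact q.Prime], q ∣ N →
    p ≠ 2 → Surj W p → W.analyticRank ≤ 1 →
    padicValNat p W.shaOrder + 2 * padicValNat p ((W.baseChange ℚ_[q]).localTamagawaNumber ℤ_[q]) ≤
      2 * padicValNat p (AddSubgroup.zmultiples P).index

/-- **The certificate case `ord_p [E(K) : ℤ y_K] ≤ ord_p c_q`** of Miller's Thm. 5.4 under the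
hypotheses of Thm. 4.4: for `E/ℚ` of analytic rank `≤ 1` with `ρ̄_{E,p}` surjective (`p` odd), a
Heegner field `K`, a Heegner point `y_K` of infinite order, and ONE prime `q ∣ N` whose Tamagawa
number absorbs the whole `p`-part of the index, `ord_p #Ш(E/ℚ) = 0`. (Typical JET certificate:
`ord_p [E(K):ℤ y_K] = 1 = ord_p c_q` at the one carrier `q`; Miller's "if `p` divides at most one
Tamagawa number then this upper bound is equal to `ord_p(#Ш(ℚ,E)_an)`".) PROVED from the fact.
[cite: Miller2011LMS, Thm. 5.4 (arXiv:1010.2431 p. 11)] -/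
theorem padicValNat_shaOrder_eq_zero_of_index_le_tamagawa_of_surj
    (h : thm54_surj_padicValNat_shaOrder_add_tamagawa_le)
    (W : WeierstrassCurve ℚ) [W.IsElliptic] [W.IsGloballyMinimal] {N : ℕ} [NeZero N]
    {K : Type} [Field K] [NumberField K] (hK : IsImaginaryQuadratic K)
    (hH : SatisfiesHeegnerHypothesis N K) {P : (W.baseChange K).toAffine.Point}
    (hP : IsHeegnerPoint N W K P) (hnt : ¬ IsOfFinAddOrder P) (p : ℕ) [Fact p.Prime]
    (q : ℕ) [Fact q.Prime] (hqN : q ∣ N)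
    (hp2 : p ≠ 2) (hρ : Surj W p) (hr : W.analyticRank ≤ 1)
    (hI : padicValNat p (AddSubgroup.zmultiples P).index ≤
      padicValNat p ((W.baseChange ℚ_[q]).localTamagawaNumber ℤ_[q])) :
    padicValNat p W.shaOrder = 0 := by
  have hle := h W N K hK hH P hP hnt p q hqN hp2 hρ hr
  omega

/-- **Numeric form** of Miller's Thm. 5.4 under the hypotheses of Thm. 4.4: from an upper bound
`ord_p [E(K) : ℤ y_K] ≤ v` (the computed Heegner index) and a lower bound `w ≤ ord_p c_q` at one
prime `q ∣ N`, `ord_p #Ш(E/ℚ) ≤ 2(v − w)` (in `ℕ`, truncated at `0`). PROVED from the fact.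
[cite: Miller2011LMS, Thm. 5.4 (arXiv:1010.2431 p. 11)] -/
theorem padicValNat_shaOrder_le_of_index_sub_tamagawa_of_surj
    (h : thm54_surj_padicValNat_shaOrder_add_tamagawa_le)
    (W : WeierstrassCurve ℚ) [W.IsElliptic] [W.IsGloballyMinimal] {N : ℕ} [NeZero N]
    {K : Type} [Field K] [NumberField K] (hK : IsImaginaryQuadratic K)
    (hH : SatisfiesHeegnerHypothesis N K) {P : (W.baseChange K).toAffine.Point}
    (hP : IsHeegnerPoint N W K P) (hnt : ¬ IsOfFinAddOrder P) (p : ℕ) [Fact p.Prime]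
    (q : ℕ) [Fact q.Prime] (hqN : q ∣ N)
    (hp2 : p ≠ 2) (hρ : Surj W p) (hr : W.analyticRank ≤ 1) {v w : ℕ}
    (hv : padicValNat p (AddSubgroup.zmultiples P).index ≤ v)
    (hw : w ≤ padicValNat p ((W.baseChange ℚ_[q]).localTamagawaNumber ℤ_[q])) :
    padicValNat p W.shaOrder ≤ 2 * (v - w) := by
  have hle := h W N K hK hH P hP hnt p q hqN hp2 hρ hr
  omega

/-- **Thm. 4.4's own bound recovered**: dropping the Tamagawa term at any prime `q ∣ N` gives
Kolyvagin's bound over `ℚ` as printed in Miller's Thm. 4.4,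
`ord_p #Ш(E/ℚ) ≤ 2·ord_p [E(K) : ℤ P]` (surjective `ρ̄_{E,p}`, `p` odd, `r_an(E) ≤ 1`, `y_K` of
infinite order). PROVED from the fact; stated with a witness prime `q ∣ N` (every conductor has one).
[cite: Miller2011LMS, Thm. 4.4 (arXiv:1010.2431 p. 9) and Thm. 5.4 (p. 11)] -/
theorem padicValNat_shaOrder_le_two_mul_index_of_surj
    (h : thm54_surj_padicValNat_shaOrder_add_tamagawa_le)
    (W : WeierstrassCurve ℚ) [W.IsElliptic] [W.IsGloballyMinimal] {N : ℕ} [NeZero N]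
    {K : Type} [Field K] [NumberField K] (hK : IsImaginaryQuadratic K)
    (hH : SatisfiesHeegnerHypothesis N K) {P : (W.baseChange K).toAffine.Point}
    (hP : IsHeegnerPoint N W K P) (hnt : ¬ IsOfFinAddOrder P) (p : ℕ) [Fact p.Prime]
    (q : ℕ) [Fact q.Prime] (hqN : q ∣ N)
    (hp2 : p ≠ 2) (hρ : Surj W p) (hr : W.analyticRank ≤ 1) :
    padicValNat p W.shaOrder ≤ 2 * padicValNat p (AddSubgroup.zmultiples P).index := by
  have hle := h W N K hK hH P hP hnt p q hqN hp2 hρ hr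
  omega

end Literature.NumberTheory.EllipticCurves.Miller2011

end
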